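import Summits.Parity.BatemanHorn.Theorems.RoughValueTransportAssembly
import Summits.Parity.BatemanHorn.Theorems.RoughValueTransportSieveCalibration
import Summits.Parity.BatemanHorn.Theorems.BalancedSemiprimeLayer.Negative.RelativeConsistency
import Summits.Parity.BatemanHorn.Theorems.RoughValueTransportBalancedSemiprimeLayerSplit
import HarnessLib

/-!
# Crux `BalancedSemiprimeLayer` (stmt-Parity-9469): PLACEMENT certificate of the redirect strategist r1

Helper file `--supports stmt-Parity-9469` (crux-strategist r1, second opinion after the p1 census
`Cruxes/BalancedSemiprimeLayer/STRATEGY-CENSUS.md`). It records, as kernel-checked one-liners over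
LANDED theorems, where the crux sits logically, so that the tribunal can close the crux chain:

* `balancedSemiprimeLayer_iff_batemanHorn_of_roughValueLaw` — **relative summit equivalence**:
  `RoughValueLaw → (BalancedSemiprimeLayer ↔ BatemanHorn)`.  `→` is the route's PROVED Assembly
  (`roughValueTransportAssembly_proof`, stmt-Parity-11392) with the PROVED support
  `sieveCalibration_proof` (stmt-Parity-11391); `←` is the disprover's PROVED relative consistency
  `Negative.cruxConclusion_of_roughValueLaw_of_sieveCalibration_of_batemanHorn` (p70540).
  Reading: inside route RoughValueTransport (whose deciding theorem consumes `RoughValueLaw`) the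
  crux is interchangeable with the sub-problem statement itself — proving it GIVEN the rank-2 crux is
  proving Bateman–Horn given the rank-2 crux.  It is NOT an absolute equivalence: neither
  `BalancedSemiprimeLayer → BatemanHorn` nor `BatemanHorn → BalancedSemiprimeLayer` is a tree theorem
  or a cheap consequence of one (probes recorded in the r1 census), so the crux is not the summit
  reworded; it is an upper bound of the right order for a boundary layer, blocked by technique.
* `higherLayer_iff_batemanHorn_of_roughValueLaw` — the same for the crux's open residual
  `LayerHigher` (degree-≥-3 coordinates; `Split.balancedSemiprimeLayer_iff_higherLayer_unfolded`,
  p83112/p78616/p75295): given `RoughValueLaw`, the ONLY open content of the crux is equivalent to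
  Bateman–Horn.
* `divisorSum_eq_on_rough` — **divisor-sum blindness on rough integers** (the two-line reason the
  degree threshold is exactly 3): a weight `Σ_{e ∣ m, 1 ≤ e ≤ D} w e` takes the constant value `w 1`
  on every integer `m` all of whose prime factors are `≥ z > D`.  For a coordinate of degree `d` the
  layer lives on values free of primes `< z = x^{d(1−δ)/2}`, while divisibility of `fᵢ(n)`, `n ≤ x`,
  by `e` is Type-I information only for `e ≤ x^{1+o(1)}`; `z > x` iff `d(1−δ)/2 > 1`, i.e. (with
  `δ ≤ 1/4`) iff `d ≥ 3` (`Negative.nine_eighths_le_cruxExponent`): every upper-bound sieve weight of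
  admissible level is CONSTANT on the degree-≥-3 layer and cannot separate prime values from balanced
  semiprime values, whereas for `d ≤ 2` the window `[x^{d(1−δ)/2}, x^{d/2}]` is inside the admissible
  level — which is exactly the landed degree-≤-2 proof (divisor switching + Hooley).
-/

namespace Summit.Parity.BatemanHorn.Theorems.BalancedSemiprimeLayer.Placement

open Finset
open Summit.Parity.BatemanHorn.Theses.RoughValueTransport
open Summit.Parity.BatemanHorn.Theorems (roughValueTransportAssembly_proof sieveCalibration_proof)
open Summit.Parity.BatemanHorn.Theorems.BalancedSemiprimeLayer.Negative
  (cruxConclusion_of_roughValueLaw_of_sieveCalibration_of_batemanHorn)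
open Summit.Parity.BatemanHorn.Cruxes.BalancedSemiprimeLayer.SmoothModulusTwistedHooley
  (Split.balancedSemiprimeLayer_iff_higherLayer_unfolded)

/-- **Relative summit equivalence.** Given the route's rank-2 crux `RoughValueLaw`, the rank-3 crux
`BalancedSemiprimeLayer` is EQUIVALENT to the sub-problem statement `BatemanHorn`: `→` by the proved
Assembly and SieveCalibration, `←` by the proved relative consistency. [folklore] -/
theorem balancedSemiprimeLayer_iff_batemanHorn_of_roughValueLaw :
    RoughValueLaw → (BalancedSemiprimeLayer ↔ _root_.BatemanHorn) :=
  fun hR =>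
    ⟨fun hL => roughValueTransportAssembly_proof hR hL sieveCalibration_proof,
     fun hB _ f hf ε hε =>
       cruxConclusion_of_roughValueLaw_of_sieveCalibration_of_batemanHorn hR sieveCalibration_proof hB
         f hf ε hε⟩

/-- The two open cruxes of the route together are EQUIVALENT to `RoughValueLaw ∧ BatemanHorn`
(so, jointly, they are at least the summit; the joint statement is strictly a conjunct split only if
`BatemanHorn → RoughValueLaw`, which is not known). [folklore] -/
theorem roughValueLaw_and_layer_iff :
    (RoughValueLaw ∧ BalancedSemiprimeLayer) ↔ (RoughValueLaw ∧ _root_.BatemanHorn) :=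
  ⟨fun h => ⟨h.1, (balancedSemiprimeLayer_iff_batemanHorn_of_roughValueLaw h.1).mp h.2⟩,
   fun h => ⟨h.1, (balancedSemiprimeLayer_iff_batemanHorn_of_roughValueLaw h.1).mpr h.2⟩⟩

/-- **The open residual, placed.** Given `RoughValueLaw`, the degree-≥-3 coordinate layer
`LayerHigher` (the crux's only open content: degrees `≤ 2` are proved, `Split.layerLinear_unfolded`,
`Split.layerQuadratic_unfolded`) is EQUIVALENT to `BatemanHorn`. [folklore] -/
theorem higherLayer_iff_batemanHorn_of_roughValueLaw (hR : RoughValueLaw) :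
    (∀ (k : ℕ) (f : Fin k → Polynomial ℤ), Literature.NumberTheory.Sieve.IsBatemanHornSystem f →
        ∀ i : Fin k, 3 ≤ (f i).natDegree → ∀ ε : ℝ, 0 < ε → ∃ δ : ℝ, 0 < δ ∧ δ ≤ 1 / 4 ∧
          ∀ᶠ x : ℕ in Filter.atTop,
            (((Finset.Icc 1 x).filter (fun n : ℕ => (∀ j, 0 < (f j).eval (n : ℤ) ∧
                ∀ p ∈ Finset.range ⌈(x : ℝ) ^ (((f j).natDegree : ℝ) * (1 - δ) / 2)⌉₊,
                  p.Prime → ¬ ((p : ℤ) ∣ (f j).eval (n : ℤ))) ∧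
                ¬ ((f i).eval (n : ℤ)).toNat.Prime)).card : ℝ) ≤ ε * (x : ℝ) / Real.log x ^ k) ↔
      _root_.BatemanHorn :=
  Split.balancedSemiprimeLayer_iff_higherLayer_unfolded.symm.trans
    (balancedSemiprimeLayer_iff_batemanHorn_of_roughValueLaw hR)

/-- **Divisor-sum blindness on rough integers.** If every prime factor of `m` is `≥ z` and `D < z`,
then the divisors of `m` in `[1, D]` reduce to `{1}`. [folklore] -/
theorem filter_dvd_Icc_eq_singleton_of_rough {D z m : ℕ} (hD : 1 ≤ D) (hDz : D < z)
    (hm : ∀ p : ℕ, p.Prime → p ∣ m → z ≤ p) :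
    (Icc 1 D).filter (fun e => e ∣ m) = {1} := by
  ext e
  simp only [mem_filter, mem_Icc, mem_singleton]
  constructor
  · rintro ⟨⟨h1, hD'⟩, hdvd⟩
    by_contra hne
    obtain ⟨p, hp, hpe⟩ := Nat.exists_prime_and_dvd hne
    have hpz : z ≤ p := hm p hp (dvd_trans hpe hdvd)
    have hple : p ≤ e := Nat.le_of_dvd (by omega) hpe
    omega
  · rintro rfl
    exact ⟨⟨le_refl 1, hD⟩, one_dvd m⟩

/-- **Divisor-sum blindness, weight form**: any divisor-sum weight of level `D` is CONSTANT (`= w 1`)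
on the integers free of prime factors `< z` as soon as `z > D`.  With `D ≤ x^{1+o(1)}` (the Type-I
range for `{fᵢ(n)}_{n ≤ x}`) and `z = x^{deg fᵢ(1−δ)/2} ≥ x^{9/8}` for `deg fᵢ ≥ 3`, `δ ≤ 1/4`, every
admissible upper-bound sieve weight is constant on the degree-≥-3 layer. [folklore] -/
theorem divisorSum_eq_on_rough {D z m : ℕ} (hD : 1 ≤ D) (hDz : D < z)
    (hm : ∀ p : ℕ, p.Prime → p ∣ m → z ≤ p) (w : ℕ → ℝ) :
    ∑ e ∈ (Icc 1 D).filter (fun e => e ∣ m), w e = w 1 := by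
  rw [filter_dvd_Icc_eq_singleton_of_rough hD hDz hm, sum_singleton]

end Summit.Parity.BatemanHorn.Theorems.BalancedSemiprimeLayer.Placement
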